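import Summits.ValiantsHypothesis.ValiantsHypothesis.Theorems.KPlusLogSqLawTropicalBColumnFanoutLift
import Summits.ValiantsHypothesis.ValiantsHypothesis.Theorems.KPlusLogSqLawTropicalBTranspose
import Summits.ValiantsHypothesis.ValiantsHypothesis.Theorems.KPlusLogSqLawTropicalBSignsFree

/-!
# Route `KPlusLogSqLaw`, crux `TropicalB` (stmt-ValiantsHypothesis-19771) — SUBCUBIC SUPPORTS ARE UNIVERSAL: the `K + log² m` law is
# equivalent to its restriction to designs with at most three present entries in every row AND in every column

HONEST FRAMING.  Helper file (seat val-sym-trop-p1 g16, cell `pub-symmetroid`, 2026-08-28) toward the registered stubs `stub_tropThin` /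
`stub_tropFat` of `Cruxes/TropicalB/Lines/birth.lean` (crux `Summit.ValiantsHypothesis.ValiantsHypothesis.Theses.KPlusLogSqLaw.TropicalB`,
item `stmt-ValiantsHypothesis-19771`, route `KPlusLogSqLaw`; `--supports … --as helper`).  COMPOSITION of tree reductions: fan out the columns
(`ColumnFanout.exists_fanout_lift`: columns of degree `≤ 3`, row degrees kept), transpose (`designRowD_of_transpose`: rows ↔ columns, census
unchanged), fan out again (columns `≤ 3`, and now the rows — the old columns of degree `≤ 3`, or new decision rows of degree `2` — stay `≤ 3`).
A NORMAL-FORM statement; it bounds nothing for `TropicalB` and bears on neither `WeakLifting`, the doors, `MatrixDescartes`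
(stmt-ValiantsHypothesis-18050) nor VP ≠ VNP.

* `tropRowD_of_subcubic` — if every design of format `(m(m+1)·(m(m+1)+1), K+2)` with at most three present rows in every column and at most
  three present columns in every row satisfies the unsigned row bound `B`, then every design of format `(m, K)` does;
* `tropicalB_of_subcubic` / `subcubic_of_tropicalB` — the crux as ONE constant for all subcubic designs (bound `2^(C·(K+1+⌊log₂ m⌋²))` at the
  format built from `(m, K)`), and the converse specialisation.

So the support of the crux may be taken to be a bipartite graph of maximum degree `3` (with `2` it is linear on the column side,
`…TropicalBTwoRowsPerColumn`): density plays no role in `TropicalB`.  [folklore] (composition of gadgets)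
-/

set_option linter.dupNamespace false
set_option autoImplicit false

namespace Summit.ValiantsHypothesis.ValiantsHypothesis.Theorems.KPlusLogSqLaw

open Summit.ValiantsHypothesis.ValiantsHypothesis.Theorems.MatrixDescartes.Negative
open Summit.ValiantsHypothesis.ValiantsHypothesis.Theorems.LacunarySymmetroidMatrixDescartes
open Summit.ValiantsHypothesis.ValiantsHypothesis.Theses.KPlusLogSqLaw (TropicalB)
open scoped BigOperators
open Finset
namespace ColumnFanout

/-- **SUBCUBIC SUPPORTS ARE UNIVERSAL.**  If every design of format `(m(m+1)·(m(m+1)+1), K+2)` in which every column has at most three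
present rows and every row at most three present columns satisfies the unsigned row bound `B`, then `TropRowD m K B`. [folklore] -/
theorem tropRowD_of_subcubic (m K B : ℕ)
    (h : ∀ (d' : Fin (K + 1 + 1) → ℕ)
      (v' ε' : Fin (m * (m + 1) * (m * (m + 1) + 1)) → Fin (m * (m + 1) * (m * (m + 1) + 1)) → Fin (K + 1 + 1) → ℤ),
      (∀ c, (Finset.univ.filter fun r => ∃ l, ε' r c l ≠ 0).card ≤ 3) →
      (∀ r, (Finset.univ.filter fun c => ∃ l, ε' r c l ≠ 0).card ≤ 3) →
      DesignRowD d' v' ε' B) :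
    TropRowD m K B := by
  intro d v ε
  obtain ⟨d₁, v₁, ε₁, hcol₁, _, htr₁⟩ := exists_fanout_lift m K d v ε
  -- transpose: the rows of the transposed design are the columns of the fanned-out one, of degree ≤ 3
  have hrowT : ∀ a : Fin (m * (m + 1)),
      (Finset.univ.filter fun b => ∃ l, (fun a b l => ε₁ b a l) a b l ≠ 0).card ≤ 3 := fun a => hcol₁ a
  obtain ⟨d₂, v₂, ε₂, hcol₂, hrow₂, htr₂⟩ :=
    exists_fanout_lift (m * (m + 1)) (K + 1) d₁ (fun a b l => v₁ b a l) (fun a b l => ε₁ b a l)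
  have hrow₂' : ∀ r, (Finset.univ.filter fun c => ∃ l, ε₂ r c l ≠ 0).card ≤ 3 :=
    fun r => (hrow₂ 3 hrowT r).trans (by norm_num)
  exact htr₁ B (designRowD_of_transpose d₁ v₁ ε₁ (htr₂ B (h d₂ v₂ ε₂ hcol₂ hrow₂')))

/-- **One constant for all subcubic designs gives `TropicalB`** (bound written at the simulated format `(m, K)`). [folklore] -/
theorem tropicalB_of_subcubic
    (h : ∃ C : ℕ, ∀ (m K : ℕ) (d' : Fin (K + 1 + 1) → ℕ)
      (v' ε' : Fin (m * (m + 1) * (m * (m + 1) + 1)) → Fin (m * (m + 1) * (m * (m + 1) + 1)) → Fin (K + 1 + 1) → ℤ),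
      (∀ c, (Finset.univ.filter fun r => ∃ l, ε' r c l ≠ 0).card ≤ 3) →
      (∀ r, (Finset.univ.filter fun c => ∃ l, ε' r c l ≠ 0).card ≤ 3) →
      DesignRowD d' v' ε' (2 ^ (C * (K + 1 + Nat.log 2 m ^ 2)))) :
    TropicalB := by
  obtain ⟨C, hC⟩ := h
  refine tropicalB_iff_unsigned.mpr ⟨2 * C, fun m K => ?_⟩
  rcases Nat.eq_zero_or_pos K with rfl | hK
  · exact tropRowD_zero m _
  · refine tropRowD_mono (Nat.pow_le_pow_right (by norm_num) ?_)
      (tropRowD_of_subcubic m K _ (fun d' v' ε' h1 h2 => hC m K d' v' ε' h1 h2))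
    nlinarith

/-- **Converse specialisation**: `TropicalB` bounds the subcubic designs too (bound written at their own format). [folklore] -/
theorem subcubic_of_tropicalB (hTB : TropicalB) :
    ∃ C : ℕ, ∀ (m K : ℕ) (d' : Fin (K + 1 + 1) → ℕ)
      (v' ε' : Fin (m * (m + 1) * (m * (m + 1) + 1)) → Fin (m * (m + 1) * (m * (m + 1) + 1)) → Fin (K + 1 + 1) → ℤ),
      DesignRowD d' v' ε' (2 ^ (C * (K + 1 + 1 + Nat.log 2 (m * (m + 1) * (m * (m + 1) + 1)) ^ 2))) := by
  obtain ⟨C, hC⟩ := tropicalB_iff_unsigned.mp hTB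
  exact ⟨C, fun m K d' v' ε' => hC _ _ d' v' ε'⟩

end ColumnFanout

end Summit.ValiantsHypothesis.ValiantsHypothesis.Theorems.KPlusLogSqLaw
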